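import Literature.IUT.HodgeTheaters.PiAvatarKitCoreThetaS5LocalWitness
import Literature.IUT.HodgeTheaters.FrobenioidBridgeModelsEx54ivInfKappa
import Literature.IUT.HodgeTheaters.KappaCoricRatGaloisLocalPlaces
import Literature.IUT.HodgeTheaters.KappaCoricRatGaloisRestrictionConstants
import Literature.IUT.HodgeTheaters.KappaCoricRatGaloisCritLocusGeom
import Literature.IUT.HodgeTheaters.KappaCoricRatGaloisClauseAGeom
import HarnessLib

/-!
# [IUTchI] Example 5.4 (iv), p. 149: the `∞κ`-LINK AT THE STUB OF RECORD — the arithmetic-function-field knit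
# `InitialThetaData.infKappaLinkArith` (GAP B = G-L5t9g8-1, item GB-10 = GAP-SIZING-B.md row D4; design (B),
# abc-iut-L5-lead RULINGS #340 (A))

S. Mochizuki, *Inter-universal Teichmüller theory I*, kurims manuscript (May 2020), Example 5.4 (iv) p. 149
ll. 3–31, with Example 5.1 (i) p. 123 / (v) p. 127, Definition 5.2 (v)–(viii) pp. 135–142 and Remark 3.1.7
(i), (ii) pp. 66–67 ([IUTchI] Ex 5.4 (iv) p.149) [claim: Mochizuki2012, status: disputed] (D-0012 claim key,
series status DISPUTED — this file INHABITS one hypothesis structure of the cell at OUR typed objects; nothing of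
the series is asserted and no side is taken on [IUTchIII] Cor. 3.12).

## What is built

abc-iut-L5-t9's `S5Local.InfKappaLink` (`FrobenioidBridgeModelsEx54ivInfKappa.lean` ★ p513361 :101) is the DATA the
`∞κ`-compatibility clause of Ex 5.4 (iv) talks about: `π₁^{rat}(†𝒟^⊛) ↷ †𝕄^⊛_{∞κ}` (global), `π₁^{rat}(‡𝒟_v) ↷
‡𝕄_{∞κv} ⊆ ‡𝕄_{∞κ×v}` (local, `v ∈ 𝕍`), «restriction of associated Kummer classes» (`resKummer`) and «the various
homomorphisms `π₁^{rat}(‡𝒟_v) → π₁^{rat}(†𝒟^⊛)`» (`ratHom`).  This file inhabits it at the stub of record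
`InitialThetaData.s5LocalThetaOfBadPairs` (`PiAvatarKitCoreThetaS5LocalWitness.lean` :251, KIT-RULE
`S5Local.ofKitCore`; its index type is `D.IndexCopy ≃ V̲`, `baseThetaDatumThetaOfBadPairs_V`) with the genuine
arithmetic-function-field MODELS built by GAP B items GB-01…GB-06, BY NAME:

* global (Ex 5.1 (i)/(v)): `globRat _ := CriticalLocus.ratGalois F = Gal(Λ_F / F(t))` (GB-01 `RatGal F`, GB-02
  `ratGalois`, the same Mathlib term, Krull topology) acting on `globInfk _ := D.critLocus.minfkCoricPair` = GB-01's
  `CoricPair.ofStableSet (RatFunc F) Λ_F (D.critLocus.minfkSet) _` — the `∞κ`-coric elements of `Λ_F` for the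
  `F`-rational strictly critical locus `D.critLocus` (GB-04), divisors counted over `F̄ ⊂ Λ_F` (GB-02's
  `geomConstants`/`geomEmb`, RULINGS #318), `G_F^{rat}`-stable by GB-02's `smul_mem_minfkSet`;
* local (Def 5.2 (v)–(viii)): `locRat/locRatGroup/locRatTop/locInfkx/locInfk x _ :=` the fields of GB-02's bundled
  layer `D.localInfKappaLayerAt (D.critLocusAt K) x` at the completion `K_v̲`, `v̲ = D.indexCopyVal x ∈ V(K)`
  (archimedean `w.Completion`, nonarchimedean `w.maximalIdeal.adicCompletion K` — GB-02's ONE completion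
  convention), locus `D.critLocusAt K` (GB-04) base-changed to `K_v̲` inside the layer — UNIFORM in `x`;
* operations (Ex 5.4 (iv) p. 149): `resKummer _ x _ _ := ι_v̲` = GB-03's `RatBaseChange.iota φ_v̲` on carriers and
  `ratHom _ x _ _ :=` GB-03's continuous `RatBaseChange.ratHom φ_v̲ : G_{K_v̲}^{rat} →ₜ* G_F^{rat}`, over the base map
  `φ_v̲ : F → K → K_v̲`; that `ι_v̲` carries `†𝕄^⊛_{∞κ}` INTO `‡𝕄_{∞κ×v}` is GB-06's geometric clause (a)
  (`isInftyKappaCoricIn_map_of_isAlgClosed` over the algebraically closed constants `F̄ ⊂ Λ_F`, GB-03's square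
  `iota_algebraMap_geom`) at the transported locus — an EQUATION between loci (`critMap_critMap`), never a cast
  between carriers.  Both operations are CONSTANT in the ambient indices `Z`, `(v, F)`, `d`, `f` — «[one
  representative of the poly-morphism]» (GAP-SIZING-B.md R5, RULINGS #315 (2): a `𝒟`-morphism `f : 𝔡.HomNF …` of the
  stub is an abstract type; dependence on `f ∈ FPolyHomNF.under δ v` is print's [AbsTopIII] Thm 1.9 transport =
  carrier C2 / item GB-14; the Inn/`Aut_ε` indeterminacy halves are theorems-in-shape ★ p510882, and the choice of
  `ι` is unique up to `G_F^{rat}` by GB-03's `exists_algEquiv_eq_iota_comp`).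

The construction is done at THREE LEVELS so that the link needs no case analysis beyond the one forced by
`Val K = InfinitePlace K ⊕ FinitePlace K`: (§1) generic over a field map `φ : L → L'` of characteristic-`0` fields and
a transported locus `S'.pts = φ (S.pts)` — `CriticalLocus.minfkCoricPair`, `iota_mem_minfkSet` (clause (a) at the
model), `resKummerOfField` and its three laws `resKummerOfField_mem_infk / _smul / _op` (the three conjuncts of
`Ex54ivInfKappaCompat`, PROVED generically); (§2) at the places `w : Val K` by `Sum` cases
(`Val.resKummerArith`, `Val.ratHomArith`, and the base-change square `Val.baseChangeSquareArith` = GB-03's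
`geomSquare φ_w` bundled with `K_w` as a `LocalBaseChangeSquare`); (§3) at the datum: `InitialThetaData.baseChangeSquareAt`
(row GB-10's datum one-liner) and THE RULED DECLARATION `InitialThetaData.infKappaLinkArith`.
PIN U: `{F K Fbar : Type u}` — the stub's `InfKappaLink` lives in `Type (u+1)` for `Fbar : Type u`, and the global /
local groups live in the universes of `F` / `K`.

HONEST LABELS (RULINGS #340 (A), #316 (i)): «(B) = arithmetic presentation over `F` inside `Λ_F`; print's `∞κ`-objects
over `F̄` embed via `geomEmb` — a C1 model-presentation choice at OUR objects (#316 (i)), no claim about print beyond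
it»; print DEFINES `π₁^{rat}`, `𝕄_{∞κ}` by group-theoretic reconstruction ([AbsTopIII] Thm 1.9, Cor 1.10) — here
they are the function-field models those are isomorphs of; at archimedean `v` print's `π₁^{rat}(‡𝒟_v)` is
Aut-holomorphic (Def 5.2 (vii)), Galois-shaped here as a MODEL label (GAP-SIZING-B.md R3); the global base is `F`
(print: `F_mod`; `C_{F_mod}` absent, `[F : F_mod] < ∞`).  STAGE 1 (C1) object, booked COUNT-NEUTRAL (#316): typed
and inhabited at OUR objects ≠ proved-in-print ≠ tokened; the clause `Ex54ivInfKappaCompat` for this link is item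
GB-12, not asserted here.  Definitions + theorems only: no instance, no notation, no axiom, no `sorry`; nothing here
asserts that abc is proved or refuted.
-/

noncomputable section

namespace Literature.IUT.HodgeTheaters

open CriticalLocus RatBaseChange
open _root_.NumberField _root_.IsDedekindDomain

universe u v w

/-! ### §1. Generic level: a field map `φ : L → L'` (characteristic `0`) and a transported locus -/

namespace CriticalLocus

section Generic

variable {L : Type u} {L' : Type v} [Field L] [Field L'] [CharZero L] [CharZero L']

/-- **`π₁^{rat}(†𝒟^⊛) ↷ †𝕄^⊛_{∞κ}` at the model, design (B)** — the GLOBAL `∞κ`-coric structure of Example 5.1 (v)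
p. 127 («a pseudo-monoid equipped with a continuous action by `π₁^{rat}(†𝒟^⊛)`»): the `∞κ`-coric elements
`𝕄_{∞κ} ⊆ Λ_L` of GB-02's `minfkSet` (divisors over `L̄ ⊂ Λ_L`) as a `CoricPair` over `G_L^{rat} = Gal(Λ_L/L(t))`,
by GB-01's `CoricPair.ofStableSet` and GB-02's stability lemma `smul_mem_minfkSet` (the companion of GB-02's local
`minfkxCoricPair`, without the unit parameter). ([IUTchI] Ex 5.1 (v) p.127) [claim: Mochizuki2012, status: disputed] -/
abbrev minfkCoricPair (S : CriticalLocus L) : CoricPair (ratGalois L) :=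
  CoricPair.ofStableSet (RatFunc L) (ratClosure L) S.minfkSet (fun σ _ hx => S.smul_mem_minfkSet σ hx)

/-- The action on `minfkCoricPair` is the Galois action on `Λ_L`. ([IUTchI] Ex 5.1 (v) p.127)
[claim: Mochizuki2012, status: disputed] -/
theorem coe_smul_minfkCoricPair (S : CriticalLocus L) (σ : ratGalois L) (x : S.minfkCoricPair.carrier) :
    ((σ • x : S.minfkCoricPair.carrier) : ratClosure L) = σ (x : ratClosure L) := rfl

/-- Elements of `minfkCoricPair` are `∞κ`-coric. ([IUTchI] Ex 5.1 (v) p.127) [claim: Mochizuki2012, status: disputed] -/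
theorem coe_mem_minfkSet (S : CriticalLocus L) (x : S.minfkCoricPair.carrier) : (x : ratClosure L) ∈ S.minfkSet := x.2

/-- `†𝕄^⊛_{∞κ}` is a pseudo-monoid ([IUTchI] §0 p. 33; `0 ∉ 𝕄_{∞κ}`). ([IUTchI] Ex 5.1 (v) p.127)
[claim: Mochizuki2012, status: disputed] -/
theorem isPseudoMonoid_minfkCoricPair (S : CriticalLocus L) : S.minfkCoricPair.pm.IsPseudoMonoid :=
  CoricPair.isPseudoMonoid_ofStableSet _ S.zero_notMem_minfkSet

omit [CharZero L] [CharZero L'] in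
/-- A locus `S'` over `L'` transported from `S` along `φ` (`S'.pts = φ (S.pts)`, e.g. `S' = S.critMap φ`) is, read
over the geometric constants, transported from `S.toGeom` along `ι|_{L̄} = iotaConstants φ` — the `hS` hypothesis of
GB-06's geometric clause-(a) theorems at `Ω := L̄`. ([IUTchI] Rmk 3.1.7 (i) p.66) [claim: Mochizuki2012, status: disputed] -/
theorem toGeom_pts_eq_map (φ : L →+* L') {S : CriticalLocus L} {S' : CriticalLocus L'}
    (hS : S'.pts = S.pts.map ⟨φ, φ.injective⟩) :
    S'.toGeom.pts = S.toGeom.pts.map ⟨iotaConstants φ, (iotaConstants φ).injective⟩ := by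
  show S'.pts.map _ = (S.pts.map _).map _
  rw [hS, Finset.map_map, Finset.map_map]
  congr 1
  ext a
  simp only [Function.Embedding.trans_apply, Function.Embedding.coeFn_mk]
  exact congrArg Subtype.val (iotaConstants_algebraMap φ a).symm

/-- **Clause (a) of Ex 5.4 (iv) at the model, element form**: the restriction `ι_φ = RatBaseChange.iota φ` carries
the `∞κ`-coric elements of `Λ_L` (locus `S`) into the `∞κ`-coric elements of `Λ_{L'}` (transported locus `S'`) —
GB-06's `isInftyKappaCoricIn_map_of_isAlgClosed` over the ALGEBRAICALLY CLOSED constants `L̄ = geomConstants L`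
(`isAlgClosed_geomConstants`) and GB-03's geometric square `iota_algebraMap_geom`.
([IUTchI] Ex 5.4 (iv) p.149) [claim: Mochizuki2012, status: disputed] -/
theorem iota_mem_minfkSet (φ : L →+* L') {S : CriticalLocus L} {S' : CriticalLocus L'}
    (hS : S'.pts = S.pts.map ⟨φ, φ.injective⟩) {x : ratClosure L} (hx : x ∈ S.minfkSet) :
    iota φ x ∈ S'.minfkSet := by
  letI : Algebra (RatFunc (geomConstants L)) (ratClosure L) := (geomEmb L).toRingHom.toAlgebra
  letI : Algebra (RatFunc (geomConstants L')) (ratClosure L') := (geomEmb L').toRingHom.toAlgebra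
  haveI : IsAlgClosed (geomConstants L) := isAlgClosed_geomConstants
  exact isInftyKappaCoricIn_map_of_isAlgClosed (iotaConstants φ) (toGeom_pts_eq_map φ hS) (iota φ)
    (iota_algebraMap_geom φ) hx

/-- `ι_φ` carries `∞κ`-coric elements into `∞κ×`-coric ones for any unit parameter `U' ∋ 1`
(`𝕄_{∞κv} ⊆ 𝕄_{∞κ×v}`). ([IUTchI] Ex 5.4 (iv) p.149) [claim: Mochizuki2012, status: disputed] -/
theorem iota_mem_minfkxSet (φ : L →+* L') {S : CriticalLocus L} {S' : CriticalLocus L'}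
    (hS : S'.pts = S.pts.map ⟨φ, φ.injective⟩) {U' : Set L'} (hU' : (1 : L') ∈ U') {x : ratClosure L}
    (hx : x ∈ S.minfkSet) : iota φ x ∈ S'.minfkxSet U' :=
  S'.minfkSet_subset_minfkxSet hU' (iota_mem_minfkSet φ hS hx)

/-- **`resKummer` at the model, generic level**: «the operation of restriction of associated Kummer classes»
`†𝕄^⊛_{∞κ} → ‡𝕄_{∞κ×v}` for a characteristic-`0` field `L'` over `φ : L → L'` — `ι_φ` on carriers, landing in the
`∞κ×`-coric pair of GB-02's layer `LocalInfKappaLayer.ofField L' S' U'` by clause (a). ONE representative of the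
poly-morphism (R5). ([IUTchI] Ex 5.4 (iv) p.149) [claim: Mochizuki2012, status: disputed] -/
def resKummerOfField (φ : L →+* L') {S : CriticalLocus L} {S' : CriticalLocus L'}
    (hS : S'.pts = S.pts.map ⟨φ, φ.injective⟩) {U' : Set L'} (hU' : (1 : L') ∈ U') :
    S.minfkCoricPair.carrier → ((LocalInfKappaLayer.ofField L' S' U').kit.infkx).carrier :=
  fun m => ⟨iota φ (m : ratClosure L), iota_mem_minfkxSet φ hS hU' m.2⟩

variable (φ : L →+* L') {S : CriticalLocus L} {S' : CriticalLocus L'} (hS : S'.pts = S.pts.map ⟨φ, φ.injective⟩)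
  {U' : Set L'} (hU' : (1 : L') ∈ U')

/-- On underlying elements `resKummerOfField` is `ι_φ` (= the carrier map `(geomSquare φ).ι` of GB-03's square).
([IUTchI] Ex 5.4 (iv) p.149) [claim: Mochizuki2012, status: disputed] -/
@[simp] theorem coe_resKummerOfField (m : S.minfkCoricPair.carrier) :
    ((resKummerOfField φ hS hU' m : ((LocalInfKappaLayer.ofField L' S' U').kit.infkx).carrier) : ratClosure L') =
      iota φ (m : ratClosure L) := rfl

/-- **Clause (a)** («lands in `‡𝕄_{∞κv}`»), generic level. ([IUTchI] Ex 5.4 (iv) p.149) [claim: Mochizuki2012, status: disputed] -/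
theorem resKummerOfField_mem_infk (m : S.minfkCoricPair.carrier) :
    resKummerOfField φ hS hU' m ∈ (LocalInfKappaLayer.ofField L' S' U').kit.infk :=
  iota_mem_minfkSet φ hS m.2

/-- **Clause (b)** («equivariant with respect to … `π₁^{rat}(‡𝒟_v) → π₁^{rat}(†𝒟^⊛)`»), generic level:
`resKummer (ratHom γ • m) = γ • resKummer m` for GB-03's `ratHom φ` (its defining square `iota_ratHom_apply`).
([IUTchI] Ex 5.4 (iv) p.149) [claim: Mochizuki2012, status: disputed] -/
theorem resKummerOfField_smul (γ : ratGalois L') (m : S.minfkCoricPair.carrier) :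
    resKummerOfField φ hS hU' (RatBaseChange.ratHom φ γ • m) = γ • resKummerOfField φ hS hU' m :=
  Subtype.ext (iota_ratHom_apply φ γ (m : ratClosure L))

/-- **Clause (c)** (a morphism of pseudo-monoids, §0 p. 33), generic level: `ι_φ` is multiplicative, so a product
defined in `†𝕄^⊛_{∞κ}` is carried to the product in `‡𝕄_{∞κ×v}`. ([IUTchI] Ex 5.4 (iv) p.149)
[claim: Mochizuki2012, status: disputed] -/
theorem resKummerOfField_op (p : S.minfkCoricPair.pm.dom) :
    ∃ h : (resKummerOfField φ hS hU' p.1.1, resKummerOfField φ hS hU' p.1.2) ∈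
        (LocalInfKappaLayer.ofField L' S' U').kit.infkx.pm.dom,
      resKummerOfField φ hS hU' (S.minfkCoricPair.pm.op p) =
        (LocalInfKappaLayer.ofField L' S' U').kit.infkx.pm.op
          ⟨(resKummerOfField φ hS hU' p.1.1, resKummerOfField φ hS hU' p.1.2), h⟩ := by
  have hmul : iota φ ((p.1.1 : ratClosure L) * p.1.2) = iota φ p.1.1 * iota φ p.1.2 := map_mul _ _ _
  refine ⟨?_, Subtype.ext hmul⟩
  show iota φ (p.1.1 : ratClosure L) * iota φ p.1.2 ∈ S'.minfkxSet U'
  rw [← hmul]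
  exact iota_mem_minfkxSet φ hS hU' p.2

end Generic

end CriticalLocus

/-! ### §2. At the places `w ∈ V(K)` over a number field `F ⊆ K` (`Val K = InfinitePlace K ⊕ FinitePlace K`) -/

section Places

variable {F : Type u} (K : Type v) [Field F] [NumberField F] [Field K] [NumberField K] [Algebra F K]

omit [NumberField F] [NumberField K] in
/-- The locus transported `F → K → L'` has points `φ (S.pts)` for `φ : F → K → L'` (`baseChange = critMap`,
`critMap_critMap`) — the `hS` hypothesis of §1 at the local layers of GB-02, an equation between loci.
([IUTchI] Rmk 3.1.7 (i) p.66) [claim: Mochizuki2012, status: disputed] -/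
theorem baseChange_critMap_pts (T : CriticalLocus F) {L' : Type w} [Field L'] (φ : K →+* L') :
    ((T.critMap (algebraMap F K)).baseChange φ).pts =
      T.pts.map ⟨φ.comp (algebraMap F K), (φ.comp (algebraMap F K)).injective⟩ := by
  show ((T.critMap (algebraMap F K)).critMap φ).pts = _
  rw [critMap_critMap]
  rfl

/-- **A base-change square out of `F`, BUNDLED with its local field** — the TYPE of row GB-10's datum
one-liner, uniform in the place (the local field `K_v` is carried as a structure field, like the group of GB-02's
`LocalInfKappaLayer`; its `Field` structure is NOT registered as an instance): `loc = K_v` and GB-03's ruled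
`BaseChangeSquare F̄(t) → K̄_v(t)`, `Λ_F → Λ_{K_v}` at the (non-instance) `geomEmb` algebra structures of design (B).
([IUTchI] Ex 5.4 (iv) p.149) [claim: Mochizuki2012, status: disputed] -/
structure LocalBaseChangeSquare (F : Type u) [Field F] where
  /-- the local field `K_v` … -/
  loc : Type v
  /-- … a field -/
  [locField : Field loc]
  /-- the square over `φ_v : F → K_v` (design (B): constants `F̄ → K̄_v`, carriers `Λ_F → Λ_{K_v}`) -/
  square :
    letI : Algebra (RatFunc (geomConstants F)) (ratClosure F) := (geomEmb F).toRingHom.toAlgebra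
    letI : Algebra (RatFunc (geomConstants loc)) (ratClosure loc) := (geomEmb loc).toRingHom.toAlgebra
    BaseChangeSquare (geomConstants F) (geomConstants loc) (ratClosure F) (ratClosure loc)

variable (F) in
/-- **The base-change square at `w ∈ V(K)`, UNIFORM in the place** (design (B), GB-03's `geomSquare φ_w`,
`φ_w : F → K → K_w`; archimedean `K_w = w.Completion`, nonarchimedean `K_w = w.maximalIdeal.adicCompletion K` —
GB-02's completion convention): constants `F̄ → K̄_w` along `ι|_{F̄}`, carriers `Λ_F → Λ_{K_w}` along
`ι_w = iota φ_w` = `resKummer` on elements (`coe_resKummerOfField`). ([IUTchI] Ex 5.4 (iv) p.149)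
[claim: Mochizuki2012, status: disputed] -/
def Val.baseChangeSquareArith : Val K → LocalBaseChangeSquare.{u, v} F
  | Sum.inl w => { loc := w.Completion, square := geomSquare ((algebraMap K w.Completion).comp (algebraMap F K)) }
  | Sum.inr w =>
    { loc := w.maximalIdeal.adicCompletion K
      square := geomSquare ((algebraMap K (w.maximalIdeal.adicCompletion K)).comp (algebraMap F K)) }

omit [NumberField F] in
/-- The local field of the square at a nonarchimedean `w` is `K_w = w.maximalIdeal.adicCompletion K` (GB-02's and
the tree's `KvAt` convention). ([IUTchI] Ex 5.4 (iv) p.149) [claim: Mochizuki2012, status: disputed] -/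
theorem Val.baseChangeSquareArith_non_loc (w : FinitePlace K) :
    (Val.baseChangeSquareArith F K (Val.non w)).loc = w.maximalIdeal.adicCompletion K := rfl

variable (T : CriticalLocus F)

/-- `resKummer` at an archimedean `w`: §1's `resKummerOfField` at `φ_w : F → K → K_w`, landing in GB-02's
`localInfKappaLayerArch K (T.critMap (F → K)) w` (units `‖c‖ = 1`). ([IUTchI] Ex 5.4 (iv) p.149)
[claim: Mochizuki2012, status: disputed] -/
def resKummerArch (w : InfinitePlace K) :
    letI := (localInfKappaLayerArch K (T.critMap (algebraMap F K)) w).ratGroup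
    letI := (localInfKappaLayerArch K (T.critMap (algebraMap F K)) w).ratTop
    T.minfkCoricPair.carrier → ((localInfKappaLayerArch K (T.critMap (algebraMap F K)) w).kit.infkx).carrier :=
  haveI := charZero_infinitePlaceCompletion K w
  resKummerOfField ((algebraMap K w.Completion).comp (algebraMap F K)) (baseChange_critMap_pts K T _)
    (one_mem_archUnits K w)

/-- `resKummer` at a nonarchimedean `w`: §1's `resKummerOfField` at `φ_w : F → K → K_w`, landing in GB-02's
`localInfKappaLayerNonarch K (T.critMap (F → K)) w` (units `𝒪^×_{K_w}`). ([IUTchI] Ex 5.4 (iv) p.149)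
[claim: Mochizuki2012, status: disputed] -/
def resKummerNonarch (w : FinitePlace K) :
    letI := (localInfKappaLayerNonarch K (T.critMap (algebraMap F K)) w).ratGroup
    letI := (localInfKappaLayerNonarch K (T.critMap (algebraMap F K)) w).ratTop
    T.minfkCoricPair.carrier → ((localInfKappaLayerNonarch K (T.critMap (algebraMap F K)) w).kit.infkx).carrier :=
  haveI := charZero_adicCompletion K w
  resKummerOfField ((algebraMap K (w.maximalIdeal.adicCompletion K)).comp (algebraMap F K))
    (baseChange_critMap_pts K T _) (one_mem_nonarchUnits K w)

/-- **`resKummer` at `w ∈ V(K)`, UNIFORM in the place** (by the `Sum` cases of `Val K`), landing in GB-02's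
`Val.localInfKappaLayer K (T.critMap (F → K)) w`. ([IUTchI] Ex 5.4 (iv) p.149) [claim: Mochizuki2012, status: disputed] -/
def Val.resKummerArith : (w : Val K) →
    letI := (Val.localInfKappaLayer K (T.critMap (algebraMap F K)) w).ratGroup
    letI := (Val.localInfKappaLayer K (T.critMap (algebraMap F K)) w).ratTop
    T.minfkCoricPair.carrier → ((Val.localInfKappaLayer K (T.critMap (algebraMap F K)) w).kit.infkx).carrier
  | Sum.inl w => resKummerArch K T w
  | Sum.inr w => resKummerNonarch K T w

/-- **`ratHom` at `w ∈ V(K)`, UNIFORM in the place**: GB-03's continuous `RatBaseChange.ratHom φ_w :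
Gal(Λ_{K_w}/K_w(t)) →ₜ* Gal(Λ_F/F(t))` out of the group of GB-02's layer at `w` (its bundled group structure and
Krull topology bound inline). ([IUTchI] Ex 5.4 (iv) p.149) [claim: Mochizuki2012, status: disputed] -/
def Val.ratHomArith (S : CriticalLocus K) : (w : Val K) →
    letI := (Val.localInfKappaLayer K S w).ratGroup
    letI := (Val.localInfKappaLayer K S w).ratTop
    ContinuousMonoidHom (Val.localInfKappaLayer K S w).rat (ratGalois F)
  | Sum.inl w => RatBaseChange.ratHom ((algebraMap K w.Completion).comp (algebraMap F K))
  | Sum.inr w => RatBaseChange.ratHom ((algebraMap K (w.maximalIdeal.adicCompletion K)).comp (algebraMap F K))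

/-- At an archimedean valuation the uniform `resKummer` is the archimedean one. ([IUTchI] Ex 5.4 (iv) p.149)
[claim: Mochizuki2012, status: disputed] -/
theorem Val.resKummerArith_arc (w : InfinitePlace K) :
    Val.resKummerArith K T (Val.arc w) = resKummerArch K T w := rfl

/-- At a nonarchimedean valuation the uniform `resKummer` is the nonarchimedean one. ([IUTchI] Ex 5.4 (iv) p.149)
[claim: Mochizuki2012, status: disputed] -/
theorem Val.resKummerArith_non (w : FinitePlace K) :
    Val.resKummerArith K T (Val.non w) = resKummerNonarch K T w := rfl

end Places

/-! ### §3. At the genuine initial Θ-data: the datum one-liner and THE LINK (row GB-10) -/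

section Datum

variable {F K Fbar : Type u} [Field F] [NumberField F] [Field K] [NumberField K]
  [Algebra F K] [Field Fbar] [Algebra F Fbar] [Algebra K Fbar]
  {E : WeierstrassCurve F} [E.IsElliptic] {l : ℕ} {Pb : BadPlacePredicates K}
  (D : InitialThetaData F K Fbar E l Pb) (CG : D.geom.pe.CuspGalois) (hS : D.CuspClassesNormaliserStable) [Fact l.Prime]
  (M : D.TorsionMonodromy) (hA : D.geom.pe.ArrowCoveringClaims)
  (hI : ∀ k ∈ D.geom.pe.inertia D.geom.pe.ε1, M.tau (D.geom.embK k) = 0)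
  (B : ∀ v, v ∈ D.indexCopyBad → D.BadPairAt v) (ΛBad : ∀ v (h : v ∈ D.indexCopyBad), D.LocalArrowLaw CG hS (B v h).H)

namespace InitialThetaData

/-- **Row GB-10's datum one-liner — the base-change square at the index `x` of `V̲`** (`v̲ = D.indexCopyVal x`):
GB-03's `geomSquare φ_v̲` over `φ_v̲ : F → K → K_v̲`, bundled with `K_v̲`, uniform in `x`.
([IUTchI] Ex 5.4 (iv) p.149) [claim: Mochizuki2012, status: disputed] -/
abbrev baseChangeSquareAt (x : D.IndexCopy) : LocalBaseChangeSquare.{u, u} F :=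
  Val.baseChangeSquareArith F K (D.indexCopyVal x)

variable {Gv : D.IndexCopy → Subgroup (Fbar ≃ₐ[F] Fbar)}
  (ES : ∀ v, v ∈ D.indexCopyBad → EvalSectionBinder (D.localDataOfBadPairs CG hS M hA hI B ΛBad v) (Gv v))

/-- **GAP B item GB-10, THE RULED DECLARATION — the `∞κ`-link of [IUTchI] Example 5.4 (iv) INHABITED at the stub of
record `s5LocalThetaOfBadPairs`, design (B)** (RULINGS #340 (A): «(B) = arithmetic presentation over `F` inside
`Λ_F`; print's `∞κ`-objects over `F̄` embed via `geomEmb` — a C1 model-presentation choice at OUR objects (#316 (i)),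
no claim about print beyond it»): `globRat := Gal(Λ_F/F(t))`, `globInfk := D.critLocus.minfkCoricPair`, `loc* x :=`
GB-02's `D.localInfKappaLayerAt (D.critLocusAt K) x` at `K_v̲`, `resKummer _ x _ _ := ι_v̲` and `ratHom _ x _ _ :=
ratHom_v̲` over `φ_v̲ : F → K → K_v̲` — CONSTANT in `Z / (v, F) / d / f` «[one representative of the
poly-morphism]» (R5, #315 (2); `f`-dependence = [AbsTopIII] Thm 1.9 transport = C2 / GB-14).  STAGE 1 (C1) object,
COUNT-NEUTRAL (#316); the clause `Ex54ivInfKappaCompat` for it is item GB-12.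
([IUTchI] Ex 5.4 (iv) p.149) [claim: Mochizuki2012, status: disputed] -/
def infKappaLinkArith : (D.s5LocalThetaOfBadPairs CG hS M hA hI B ΛBad ES).InfKappaLink where
  globRat _ := ratGalois F
  globRatGroup := fun _ => inferInstance
  globRatTop := fun _ => inferInstance
  globInfk _ := D.critLocus.minfkCoricPair
  locRat x _ := (D.localInfKappaLayerAt (D.critLocusAt K) x).rat
  locRatGroup := fun x _ => (D.localInfKappaLayerAt (D.critLocusAt K) x).ratGroup
  locRatTop := fun x _ => (D.localInfKappaLayerAt (D.critLocusAt K) x).ratTop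
  locInfkx := fun x _ =>
    letI := (D.localInfKappaLayerAt (D.critLocusAt K) x).ratGroup
    letI := (D.localInfKappaLayerAt (D.critLocusAt K) x).ratTop
    (D.localInfKappaLayerAt (D.critLocusAt K) x).kit.infkx
  locInfk := fun x _ =>
    letI := (D.localInfKappaLayerAt (D.critLocusAt K) x).ratGroup
    letI := (D.localInfKappaLayerAt (D.critLocusAt K) x).ratTop
    (D.localInfKappaLayerAt (D.critLocusAt K) x).kit.infk
  resKummer := fun _ x _ _ => Val.resKummerArith K D.critLocus (D.indexCopyVal x)
  ratHom := fun _ x _ _ => Val.ratHomArith K (D.critLocusAt K) (D.indexCopyVal x)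

/-! #### Bookkeeping: the fields of the link, by `rfl` -/

/-- The global coric pair of the link is `D.critLocus.minfkCoricPair`. ([IUTchI] Ex 5.1 (v) p.127)
[claim: Mochizuki2012, status: disputed] -/
theorem infKappaLinkArith_globInfk (Z : (D.s5LocalThetaOfBadPairs CG hS M hA hI B ΛBad ES).FAmbGlob) :
    (D.infKappaLinkArith CG hS M hA hI B ΛBad ES).globInfk Z = D.critLocus.minfkCoricPair := rfl

/-- `resKummer` of the link is `Val.resKummerArith` at `v̲ = D.indexCopyVal x`, whatever `Z`, `d`, `f`.
([IUTchI] Ex 5.4 (iv) p.149) [claim: Mochizuki2012, status: disputed] -/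
theorem infKappaLinkArith_resKummer {Y : (D.s5LocalThetaOfBadPairs CG hS M hA hI B ΛBad ES).FAmbG}
    {Z : (D.s5LocalThetaOfBadPairs CG hS M hA hI B ΛBad ES).FAmbGlob}
    (d : (D.s5LocalThetaOfBadPairs CG hS M hA hI B ΛBad ES).DashArrow Y Z) {x : D.IndexCopy}
    (X : (D.s5LocalThetaOfBadPairs CG hS M hA hI B ΛBad ES).FAmb x)
    (f : (D.baseThetaDatumThetaOfBadPairs CG hS M hA hI B ΛBad ES).HomNF x
      (((D.s5LocalThetaOfBadPairs CG hS M hA hI B ΛBad ES).base x).obj X)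
      ((D.s5LocalThetaOfBadPairs CG hS M hA hI B ΛBad ES).baseG Y)) :
    (D.infKappaLinkArith CG hS M hA hI B ΛBad ES).resKummer d X f =
      Val.resKummerArith K D.critLocus (D.indexCopyVal x) := rfl

/-- `ratHom` of the link is `Val.ratHomArith` at `v̲ = D.indexCopyVal x`, whatever `Z`, `d`, `f`.
([IUTchI] Ex 5.4 (iv) p.149) [claim: Mochizuki2012, status: disputed] -/
theorem infKappaLinkArith_ratHom {Y : (D.s5LocalThetaOfBadPairs CG hS M hA hI B ΛBad ES).FAmbG}
    {Z : (D.s5LocalThetaOfBadPairs CG hS M hA hI B ΛBad ES).FAmbGlob}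
    (d : (D.s5LocalThetaOfBadPairs CG hS M hA hI B ΛBad ES).DashArrow Y Z) {x : D.IndexCopy}
    (X : (D.s5LocalThetaOfBadPairs CG hS M hA hI B ΛBad ES).FAmb x)
    (f : (D.baseThetaDatumThetaOfBadPairs CG hS M hA hI B ΛBad ES).HomNF x
      (((D.s5LocalThetaOfBadPairs CG hS M hA hI B ΛBad ES).base x).obj X)
      ((D.s5LocalThetaOfBadPairs CG hS M hA hI B ΛBad ES).baseG Y)) :
    (D.infKappaLinkArith CG hS M hA hI B ΛBad ES).ratHom d X f =
      Val.ratHomArith K (D.critLocusAt K) (D.indexCopyVal x) := rfl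

/-- **NON-VACUITY**: the `∞κ`-link type over the stub of record is inhabited by the arithmetic knit.
([IUTchI] Ex 5.4 (iv) p.149) [claim: Mochizuki2012, status: disputed] -/
theorem nonempty_infKappaLink_s5LocalThetaOfBadPairs :
    Nonempty (D.s5LocalThetaOfBadPairs CG hS M hA hI B ΛBad ES).InfKappaLink :=
  ⟨D.infKappaLinkArith CG hS M hA hI B ΛBad ES⟩

end InitialThetaData

end Datum

end Literature.IUT.HodgeTheaters

end
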